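import Summits.Ventures.DiscreteObjects.Hadamard.Order25TimesPrime668

/-!
# Hadamard 668 census, family F12 — NO signed automorphism of an H(668) has pair-order `225 = 9·25` (kernel, exclusion);
# hence the odd part of an order divisible by `25` is `25` or `75`

Framing: lottery ticket; floor = certified bounds/negative ranges.

Cell pub-namedobj (venture DiscreteObjects), target (H), hadamard gen 18.  Same method as `Order25TimesPrime668`, now
for the cyclic group of order `225`: write `F_k = #Fix π^k` on the rows of a signed automorphism `(π, κ, d, e)` of an
H(668) with pair-order `225`.  Kernel inputs: `F₉ = 8`, `F₄₅ = 68` (the order-`25` part `g⁹` and its fifth power,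
`Order25FixedEight668`); `F₂₅ ≤ 74`, `F₂₅ ≡ 2 (mod 6)` (the order-`9` part `g²⁵`, `FixedGramModP`) and `F₇₅ ≡ 2 (mod 18)`,
`F₇₅ ≤ 164` (its cube, gen 17).  Orbit counting for `⟨π⟩` (exact-period sets have cardinality divisible by the period,
`dvd_card_period2`; intersections of fixed sets by Bezout, `fixed_pow_gcd`):
`3 ∣ F₃ − F₁`, `9 ∣ F₉ − F₃`, `5 ∣ F₅ − F₁`, `25 ∣ F₂₅ − F₅`, `F₁₅ = F₃ + F₅ − F₁ + 15a`, `F₄₅ = F₉ + F₁₅ − F₃ + 45b`,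
`F₇₅ = F₁₅ + F₂₅ − F₅ + 75c`, `668 = F₄₅ + F₇₅ − F₁₅ + 225e` — an infeasible integer system (`omega`).
* **`no_hadamard668_signedAut_order_225`**, **`hadamard668_signedAut_not_dvd_orderOf_225`**.
Consequence (with `PrimeCubeOrder5`: `125 ∤`, `Order25TimesPrime668`: `25q ∤` for the primes `q ≥ 7`, and the prime
spectrum): for every signed automorphism of an H(668) whose pair order `N` is divisible by `25`, the odd part of `N`
is `25` or `75`.  EXCLUSION of element orders only; H(668) untouched.  Ours; no `sorry`, no definitions.
-/

namespace Summit.Ventures.DiscreteObjects.Hadamard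

open Finset BigOperators Matrix

open Literature.Combinatorics.Designs.GoethalsSeidel (IsHadamardMatrix)

variable {ι : Type*} [Fintype ι] [DecidableEq ι]

omit [Fintype ι] [DecidableEq ι] in
/-- **Bezout for fixed points**: `(κ^a) y = y` and `(κ^b) y = y` give `(κ^gcd(a,b)) y = y`. -/
lemma fixed_pow_gcd (κ : Equiv.Perm ι) {a b : ℕ} {y : ι} (ha : (κ ^ a) y = y) (hb : (κ ^ b) y = y) :
    (κ ^ Nat.gcd a b) y = y := by
  have h1 : Function.IsPeriodicPt κ a y := by
    show (⇑κ)^[a] y = y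
    rw [Equiv.Perm.iterate_eq_pow]; exact ha
  have h2 : Function.IsPeriodicPt κ b y := by
    show (⇑κ)^[b] y = y
    rw [Equiv.Perm.iterate_eq_pow]; exact hb
  have h3 : (⇑κ)^[Nat.gcd a b] y = y := h1.gcd h2
  rw [Equiv.Perm.iterate_eq_pow] at h3
  exact h3

omit [Fintype ι] [DecidableEq ι] in
/-- `(κ^d) y = y` and `d ∣ a` give `(κ^a) y = y` -/
lemma fixed_pow_of_dvd (κ : Equiv.Perm ι) {d a : ℕ} {y : ι} (hd : (κ ^ d) y = y) (hda : d ∣ a) :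
    (κ ^ a) y = y := by
  obtain ⟨m, rfl⟩ := hda
  rw [pow_mul]; exact perm_pow_apply_of_fixed _ hd m

section counting
variable (π : Equiv.Perm ι)

/-- **points of exact period `n`** (fixed by `π^n`, not by `π^a` nor `π^b`, where every proper divisor of `n` divides `a`
or `b`) are `n`-divisible in number -/
lemma dvd_card_period2 {n a b : ℕ} (hn : 0 < n) (hdiv : ∀ d, d ∣ n → d < n → d ∣ a ∨ d ∣ b) :
    n ∣ (univ.filter fun y => (π ^ n) y = y ∧ (π ^ a) y ≠ y ∧ (π ^ b) y ≠ y).card := by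
  refine dvd_card_of_period π hn (fun y => (π ^ n) y = y ∧ (π ^ a) y ≠ y ∧ (π ^ b) y ≠ y) ?_ (fun y hy => hy.1)
    ?_ _ (fun y => by simp)
  · intro y hy
    refine ⟨by rw [pow_apply_comm π n y, hy.1], fun h => hy.2.1 ?_, fun h => hy.2.2 ?_⟩
    · rw [pow_apply_comm π a y] at h; exact π.injective h
    · rw [pow_apply_comm π b y] at h; exact π.injective h
  · intro y hy d hd hdlt hfix
    rcases hdiv d hd hdlt with h | h
    · exact hy.2.1 (fixed_pow_of_dvd π hfix h)
    · exact hy.2.2 (fixed_pow_of_dvd π hfix h)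

/-- **inclusion–exclusion for two fixed sets inside a larger one**:
`#Fix π^n = #Fix π^a + #Fix π^b − #Fix π^(gcd a b) + #(exact part)` for `a, b ∣ n`. -/
lemma card_fixed_incl_excl {n a b : ℕ} (ha : a ∣ n) (hb : b ∣ n) :
    (univ.filter fun y => (π ^ n) y = y).card + (univ.filter fun y => (π ^ Nat.gcd a b) y = y).card =
      (univ.filter fun y => (π ^ a) y = y).card + (univ.filter fun y => (π ^ b) y = y).card +
        (univ.filter fun y => (π ^ n) y = y ∧ (π ^ a) y ≠ y ∧ (π ^ b) y ≠ y).card := by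
  have h := Finset.card_filter_add_card_filter_not (s := univ.filter fun y => (π ^ n) y = y)
    (fun y => (π ^ a) y = y ∨ (π ^ b) y = y)
  rw [Finset.filter_filter, Finset.filter_filter] at h
  have e1 : (univ.filter fun y => (π ^ n) y = y ∧ ((π ^ a) y = y ∨ (π ^ b) y = y)) =
      (univ.filter fun y => (π ^ a) y = y) ∪ (univ.filter fun y => (π ^ b) y = y) := by
    ext y
    simp only [Finset.mem_filter, Finset.mem_univ, true_and, Finset.mem_union]
    constructor
    · exact fun h => h.2
    · intro h
      refine ⟨?_, h⟩
      rcases h with h | h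
      · exact fixed_pow_of_dvd π h ha
      · exact fixed_pow_of_dvd π h hb
  have e2 : (univ.filter fun y => (π ^ n) y = y ∧ ¬ ((π ^ a) y = y ∨ (π ^ b) y = y)) =
      univ.filter fun y => (π ^ n) y = y ∧ (π ^ a) y ≠ y ∧ (π ^ b) y ≠ y := by
    ext y
    simp only [Finset.mem_filter, Finset.mem_univ, true_and, not_or, ne_eq]
  rw [e1, e2] at h
  have hinter : (univ.filter fun y => (π ^ a) y = y) ∩ (univ.filter fun y => (π ^ b) y = y) =
      univ.filter fun y => (π ^ Nat.gcd a b) y = y := by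
    ext y
    simp only [Finset.mem_inter, Finset.mem_filter, Finset.mem_univ, true_and]
    constructor
    · exact fun h => fixed_pow_gcd π h.1 h.2
    · exact fun h => ⟨fixed_pow_of_dvd π h (Nat.gcd_dvd_left a b), fixed_pow_of_dvd π h (Nat.gcd_dvd_right a b)⟩
  have hUI := Finset.card_union_add_card_inter (univ.filter fun y => (π ^ a) y = y)
    (univ.filter fun y => (π ^ b) y = y)
  rw [hinter] at hUI
  omega

end counting

/-! ### divisor tables -/

/-- proper divisors of `9` divide `3` or `3` -/
lemma dvd_9_cases (d : ℕ) (hd : d ∣ 9) (hlt : d < 9) : d ∣ 3 ∨ d ∣ 3 := by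
  rcases Nat.eq_zero_or_pos d with rfl | hpos
  · simp at hd
  · interval_cases d <;> omega
/-- proper divisors of `15` divide `3` or `5` -/
lemma dvd_15_cases (d : ℕ) (hd : d ∣ 15) (hlt : d < 15) : d ∣ 3 ∨ d ∣ 5 := by
  rcases Nat.eq_zero_or_pos d with rfl | hpos
  · simp at hd
  · interval_cases d <;> omega
/-- proper divisors of `45` divide `9` or `15` -/
lemma dvd_45_cases (d : ℕ) (hd : d ∣ 45) (hlt : d < 45) : d ∣ 9 ∨ d ∣ 15 := by
  rcases Nat.eq_zero_or_pos d with rfl | hpos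
  · simp at hd
  · interval_cases d <;> omega
/-- proper divisors of `75` divide `15` or `25` -/
lemma dvd_75_cases (d : ℕ) (hd : d ∣ 75) (hlt : d < 75) : d ∣ 15 ∨ d ∣ 25 := by
  rcases Nat.eq_zero_or_pos d with rfl | hpos
  · simp at hd
  · interval_cases d <;> omega
/-- proper divisors of `225` divide `45` or `75` -/
lemma dvd_225_cases (d : ℕ) (hd : d ∣ 225) (hlt : d < 225) : d ∣ 45 ∨ d ∣ 75 := by
  rcases Nat.eq_zero_or_pos d with rfl | hpos
  · simp at hd
  · interval_cases d <;> omega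

/-- the integer system of order 225 is infeasible (staged `omega`) -/
lemma order225_arith (F1 F3 F5 F15 F25 F75 : ℕ) (a3 a9 a5 a25 n15 n45 n75 n225 : ℕ)
    (h3 : F3 = F1 + 3 * a3) (h9 : 8 = F3 + 9 * a9) (h5 : F5 = F1 + 5 * a5) (h25 : F25 = F5 + 25 * a25)
    (h15 : F15 + F1 = F3 + F5 + 15 * n15) (h45 : 68 + F3 = 8 + F15 + 45 * n45)
    (h75 : F75 + F5 = F15 + F25 + 75 * n75) (h225 : 668 + F15 = 68 + F75 + 225 * n225)
    (hw25' : F25 % 6 = 2) (hw75 : F75 ≤ 164) (hw75' : F75 % 18 = 2) : False := by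
  have hF3 : F3 = 8 := by omega
  subst hF3
  have hn45 : n45 ≤ 1 := by omega
  have hn225 : n225 ≤ 2 := by omega
  interval_cases n225 <;> interval_cases n45 <;> omega

section main
variable {H : Matrix ι ι ℤ}

/-- **No signed automorphism of pair-order `225`.** -/
theorem no_hadamard668_signedAut_order_225 (hH : IsHadamardMatrix H) (hι : Fintype.card ι = 668)
    (π κ : Equiv.Perm ι) (d e : ι → ℤ) (haut : IsSignedAut H π κ d e)
    (hπ : π ^ 225 = 1) (hκ : κ ^ 225 = 1)
    (h45 : π ^ 45 ≠ 1 ∨ κ ^ 45 ≠ 1) (h75 : π ^ 75 ≠ 1 ∨ κ ^ 75 ≠ 1) : False := by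
  -- the order-25 part (π^9, κ^9)
  have haut9 := isSignedAut_pow haut 9
  have hπ9 : (π ^ 9) ^ 25 = 1 := by rw [← pow_mul]; exact hπ
  have hκ9 : (κ ^ 9) ^ 25 = 1 := by rw [← pow_mul]; exact hκ
  have hne45 : (π ^ 9) ^ 5 ≠ 1 ∨ (κ ^ 9) ^ 5 ≠ 1 := by rw [← pow_mul, ← pow_mul]; exact h45
  obtain ⟨hF9, -, hF45, -⟩ := hadamard668_order25_fixed_eight hH hι (π ^ 9) (κ ^ 9) _ _ haut9 hπ9 hκ9 hne45
  rw [← pow_mul, show (9 : ℕ) * 5 = 45 from rfl] at hF45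
  -- the order-9 part (π^25, κ^25)
  have haut25 := isSignedAut_pow haut 25
  have hπ25 : (π ^ 25) ^ 9 = 1 := by rw [← pow_mul]; exact hπ
  have hκ25 : (κ ^ 25) ^ 9 = 1 := by rw [← pow_mul]; exact hκ
  have hne75 : (π ^ 25) ^ 3 ≠ 1 ∨ (κ ^ 25) ^ 3 ≠ 1 := by rw [← pow_mul, ← pow_mul]; exact h75
  obtain ⟨-, hw6, hw74⟩ := hadamard668_order9_fixed_eq hH hι (π ^ 25) (κ ^ 25) _ _ haut25 hπ25 hκ25 hne75
  obtain ⟨⟨hR18, -, hR164, -, -, -⟩, -⟩ := hadamard668_order9_structure hH hι (π ^ 25) (κ ^ 25) _ _ haut25 hπ25 hκ25 hne75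
  rw [← pow_mul, show (25 : ℕ) * 3 = 75 from rfl] at hR18 hR164
  -- order-9 element: rows = cols, so transfer the column facts to rows via the equality
  obtain ⟨heq9, -, -⟩ := hadamard668_order9_fixed_eq hH hι (π ^ 25) (κ ^ 25) _ _ haut25 hπ25 hκ25 hne75
  rw [← heq9] at hw6 hw74
  -- orbit counting (rows)
  have hc3 := dvd_card_fixed_pow_sdiff π (by norm_num : (3 : ℕ).Prime)
  have hc5 := dvd_card_fixed_pow_sdiff π (by norm_num : (5 : ℕ).Prime)
  have hc9 := dvd_card_period2 π (n := 9) (a := 3) (b := 3) (by norm_num) dvd_9_cases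
  have hc25 := dvd_card_period2 π (n := 25) (a := 5) (b := 5) (by norm_num)
    (fun d hd hlt => by
      have hd' : d ∣ 5 ^ 2 := by rw [show (5 : ℕ) ^ 2 = 25 from rfl]; exact hd
      obtain ⟨i, hi, rfl⟩ := (Nat.dvd_prime_pow (by norm_num : (5 : ℕ).Prime)).1 hd'
      interval_cases i
      · left; exact one_dvd _
      · left; exact dvd_rfl
      · norm_num at hlt)
  have hc15 := dvd_card_period2 π (n := 15) (a := 3) (b := 5) (by norm_num) dvd_15_cases
  have hc45 := dvd_card_period2 π (n := 45) (a := 9) (b := 15) (by norm_num) dvd_45_cases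
  have hc75 := dvd_card_period2 π (n := 75) (a := 15) (b := 25) (by norm_num) dvd_75_cases
  have hc225 := dvd_card_period2 π (n := 225) (a := 45) (b := 75) (by norm_num) dvd_225_cases
  have hs3 := card_split_by_fixed π (fun i => (π ^ 3) i = i) (fun i h => perm_pow_apply_of_fixed π h 3)
  have hs5 := card_split_by_fixed π (fun i => (π ^ 5) i = i) (fun i h => perm_pow_apply_of_fixed π h 5)
  have hs9 := card_fixed_incl_excl π (n := 9) (a := 3) (b := 3) (by norm_num) (by norm_num)
  have hs25 := card_fixed_incl_excl π (n := 25) (a := 5) (b := 5) (by norm_num) (by norm_num)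
  have hs15 := card_fixed_incl_excl π (n := 15) (a := 3) (b := 5) (by norm_num) (by norm_num)
  have hs45 := card_fixed_incl_excl π (n := 45) (a := 9) (b := 15) (by norm_num) (by norm_num)
  have hs75 := card_fixed_incl_excl π (n := 75) (a := 15) (b := 25) (by norm_num) (by norm_num)
  have hs225 := card_fixed_incl_excl π (n := 225) (a := 45) (b := 75) (by norm_num) (by norm_num)
  simp only [show Nat.gcd 3 3 = 3 by norm_num, show Nat.gcd 5 5 = 5 by norm_num, show Nat.gcd 3 5 = 1 by norm_num,
    show Nat.gcd 9 15 = 3 by norm_num, show Nat.gcd 15 25 = 5 by norm_num, show Nat.gcd 45 75 = 15 by norm_num,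
    pow_one] at hs9 hs25 hs15 hs45 hs75 hs225
  -- the whole space: Fix π^225 = everything
  have htop : (univ.filter fun y => (π ^ 225) y = y).card = 668 := by
    rw [← hι, ← Finset.card_univ]; congr 1; ext y; simp [hπ]
  -- scalarise and conclude
  obtain ⟨F1, hF1⟩ : ∃ m : ℕ, m = (univ.filter fun i => π i = i).card := ⟨_, rfl⟩
  obtain ⟨F3, hF3⟩ : ∃ m : ℕ, m = (univ.filter fun i => (π ^ 3) i = i).card := ⟨_, rfl⟩
  obtain ⟨F5, hF5⟩ : ∃ m : ℕ, m = (univ.filter fun i => (π ^ 5) i = i).card := ⟨_, rfl⟩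
  obtain ⟨F15, hF15⟩ : ∃ m : ℕ, m = (univ.filter fun i => (π ^ 15) i = i).card := ⟨_, rfl⟩
  obtain ⟨F25, hF25⟩ : ∃ m : ℕ, m = (univ.filter fun i => (π ^ 25) i = i).card := ⟨_, rfl⟩
  obtain ⟨F75, hF75⟩ : ∃ m : ℕ, m = (univ.filter fun i => (π ^ 75) i = i).card := ⟨_, rfl⟩
  obtain ⟨a3, ha3⟩ := hc3
  obtain ⟨a5, ha5⟩ := hc5
  obtain ⟨a9, ha9⟩ := hc9
  obtain ⟨a25, ha25⟩ := hc25
  obtain ⟨n15, hn15⟩ := hc15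
  obtain ⟨n45, hn45⟩ := hc45
  obtain ⟨n75, hn75⟩ := hc75
  obtain ⟨n225, hn225⟩ := hc225
  rw [ha3, ← hF1, ← hF3] at hs3
  rw [ha5, ← hF1, ← hF5] at hs5
  rw [ha9, hF9, ← hF3] at hs9
  rw [ha25, ← hF25, ← hF5] at hs25
  rw [hn15, ← hF15, ← hF1, ← hF3, ← hF5] at hs15
  rw [hn45, hF45, ← hF3, hF9, ← hF15] at hs45
  rw [hn75, ← hF75, ← hF5, ← hF15, ← hF25] at hs75
  rw [hn225, htop, ← hF15, hF45, ← hF75] at hs225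
  rw [← hF25] at hw6 hw74
  rw [← hF75] at hR18 hR164
  -- pure arithmetic from here on (keep only the scalar facts: large contexts make `omega` time out)
  clear * - hs3 hs5 hs9 hs25 hs15 hs45 hs75 hs225 hw6 hR18 hR164
  have h9' : 8 = F3 + 9 * a9 := by omega
  have h25' : F25 = F5 + 25 * a25 := by omega
  exact order225_arith F1 F3 F5 F15 F25 F75 a3 a9 a5 a25 n15 n45 n75 n225
    (by omega) h9' (by omega) h25' (by omega) (by omega) (by omega) (by omega) hw6 hR164 hR18

/-- **`225 ∤ orderOf (π, κ)`** for every signed automorphism of an H(668). -/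
theorem hadamard668_signedAut_not_dvd_orderOf_225 (hH : IsHadamardMatrix H) (hι : Fintype.card ι = 668)
    (π κ : Equiv.Perm ι) (d e : ι → ℤ) (haut : IsSignedAut H π κ d e)
    (hdvd : 225 ∣ orderOf ((π, κ) : Equiv.Perm ι × Equiv.Perm ι)) : False := by
  set x : Equiv.Perm ι × Equiv.Perm ι := (π, κ) with hx
  have hx0 : orderOf x ≠ 0 := (orderOf_pos x).ne'
  set k := orderOf x / 225 with hk
  have hord : orderOf (x ^ k) = 225 := orderOf_pow_orderOf_div hx0 hdvd
  have hxk : x ^ k = ((π ^ k, κ ^ k) : Equiv.Perm ι × Equiv.Perm ι) := by rw [hx, Prod.pow_mk]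
  rw [hxk] at hord
  obtain ⟨h1, h2, h3⟩ := pow_data_of_orderOf hord (a := 45) (by norm_num) (by norm_num)
  obtain ⟨-, -, h4⟩ := pow_data_of_orderOf hord (a := 75) (by norm_num) (by norm_num)
  exact no_hadamard668_signedAut_order_225 hH hι (π ^ k) (κ ^ k) _ _ (isSignedAut_pow haut k) h1 h2 h3 h4

end main

end Summit.Ventures.DiscreteObjects.Hadamard
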